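import Literature.NumberTheory.Automorphic.RealMatrixGroups
import Mathlib.Analysis.SpecialFunctions.Exponential
import Mathlib.LinearAlgebra.Matrix.GeneralLinearGroup.Defs
import Mathlib.LinearAlgebra.Matrix.Notation
import Mathlib.Topology.Instances.Int
import Mathlib.Topology.DiscreteSubset
import Mathlib.Topology.Connected.TotallyDisconnected
import HarnessLib

/-!
# `RealMatrixGroup.HasCartanDecomposition` is a hypothesis, not a theorem

Topic `NumberTheory/Automorphic`; sibling of `Literature.NumberTheory.Automorphic.RealMatrixGroups`.

`RealMatrixGroup.HasCartanDecomposition G` — every `g ∈ G` is `k · exp X` with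
`k ∈ K = G ∩ U(N, A)` and `X ∈ 𝔤` self-adjoint — is a *property of the linear real group* `G`
(it is used as the hypothesis `hG` of `RealMatrixGroup.isMaximalCompact_maximalCompact` and as a
regularity axiom of automorphy data), exactly as in the printed definitions of a reductive group:
Knapp–Vogan, *Cohomological Induction and Unitary Representations* (1995), Def. 4.29 (iii)
("multiplication, as a map from `K × exp 𝔭₀` into `G`, is a diffeomorphism onto" is one of the
AXIOMS of a reductive group, and "(iii) already implies that `G` has finitely many components"),
and likewise Knapp, *Lie Groups Beyond an Introduction* (2002), VII.§2 (the global Cartan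
decomposition is part of the definition of a reductive Lie group). It is proved in the tree for
the groups that matter here — `RealMatrixGroup.hasCartanDecomposition_gl` (`GL N 𝕜`, `𝕜 = ℝ, ℂ`:
the polar decomposition) and `hasCartanDecomposition_archGroupGL` (`GL_n(K_∞)`) in
`Literature.NumberTheory.Automorphic.ArchGroupGLCartan` — but it is **not** a closed statement
that could be "discharged" once and for all: this file records, sorry-free, that its universal
closure is false.

## Main statements

* `RealMatrixGroup.hasCartanDecomposition_iff_of_lie_eq_bot` — if the Lie algebra of `G` is `0`
  then `G` has the global Cartan decomposition iff `G ⊆ U(N, A)` (i.e. `G = K`).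
* `RealMatrixGroup.not_forall_hasCartanDecomposition` — over any nontrivial coefficient algebra
  `A` and nonempty index type `N` there is a linear real group without the global Cartan
  decomposition: `GL N A` itself equipped with the zero Lie algebra (a legitimate
  `RealMatrixGroup`: all axioms hold trivially), since the scalar matrix `2` is not unitary.
  Hence `∀ G, G.HasCartanDecomposition` — the only closed reading of the predicate — fails, e.g.
  for `A = ℝ`, `N = Fin 1` (`RealMatrixGroup.exists_not_hasCartanDecomposition`).

The same failure occurs for closed linear groups carrying their full Lie algebra as soon as they
have infinitely many components (Knapp–Vogan, loc. cit.: the decomposition forces finitely many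
components), e.g. the discrete group `GL_n(ℤ) ≤ GL_n(ℝ)`, `n ≥ 2`, whose Lie algebra is `0` but
which is not contained in `O(n)`; `hasCartanDecomposition_iff_of_lie_eq_bot` covers that case too.

## References

* A. W. Knapp, D. A. Vogan, *Cohomological Induction and Unitary Representations*, Princeton
  Math. Series 45 (1995), §IV.3, Def. 4.29 and Examples. [KnappVogan1995]
* A. W. Knapp, *Lie Groups Beyond an Introduction*, 2nd ed. (2002), VII.§2. [Knapp2002]
-/

-- Mathlib idiom (Mathlib/Algebra/Lie/OfAssociative.lean), as in `RealMatrixGroups` (H1)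
attribute [local instance 100] LieRing.ofAssociativeRing

open scoped MatrixGroups Matrix

open NormedSpace -- for `exp`

noncomputable section

namespace Literature.NumberTheory.Automorphic

namespace RealMatrixGroup

variable {A : Type*} [NormedCommRing A] {N : Type*} [Fintype N] [DecidableEq N]
  [NormedAlgebra ℝ A] [NormedAlgebra ℚ A] [CompleteSpace A] [StarRing A]

/-- A linear real group contained in `U(N, A)` (i.e. `G = K`) has the global Cartan decomposition,
with `X = 0`. Knapp–Vogan 1995, §IV.3, Example 1 after Def. 4.29 (`G = K` compact).
[cite: KnappVogan1995, Def. 4.29 and Example 1] -/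
theorem hasCartanDecomposition_of_carrier_le_unitarySubgroupGL (G : RealMatrixGroup A N)
    (h : G.carrier ≤ unitarySubgroupGL A N) : G.HasCartanDecomposition :=
  fun g hg ↦ ⟨g, Subgroup.mem_inf.mpr ⟨hg, h hg⟩, 0, G.lie.zero_mem, IsSelfAdjoint.zero _,
    by rw [expGL_zero, mul_one]⟩

/-- If the Lie algebra of the linear real group `G` is `0`, then `G` has the global Cartan
decomposition `G = K · exp 𝔭` iff `G ⊆ U(N, A)`, i.e. iff `G = K`: with `𝔤 = 0` the only
available `exp X` is `1`. (Knapp–Vogan 1995, Def. 4.29: property (iii) forces `G` to have finitely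
many components; a discrete `G ⊄ K` is the typical failure.) [cite: KnappVogan1995, Def. 4.29 (iii)] -/
theorem hasCartanDecomposition_iff_of_lie_eq_bot (G : RealMatrixGroup A N) (hlie : G.lie = ⊥) :
    G.HasCartanDecomposition ↔ G.carrier ≤ unitarySubgroupGL A N := by
  refine ⟨fun hG g hg ↦ ?_, G.hasCartanDecomposition_of_carrier_le_unitarySubgroupGL⟩
  obtain ⟨k, hk, X, hX, -, rfl⟩ := hG g hg
  obtain rfl : X = 0 := (LieSubalgebra.mem_bot X).mp (hlie ▸ hX)
  rw [expGL_zero, mul_one]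
  exact (Subgroup.mem_inf.mp hk).2

/-- **`HasCartanDecomposition` is not universally true.** Over a nontrivial coefficient algebra
`A` and a nonempty index type `N`, the full linear group `GL N A` equipped with the zero Lie
algebra is a `RealMatrixGroup` without the global Cartan decomposition: the scalar matrix `2`
is invertible but `2⋆ · 2 = 4 ≠ 1`, so `GL N A ⊄ U(N, A)`. Consequently the predicate
`RealMatrixGroup.HasCartanDecomposition` is a genuine hypothesis (an axiom of "reductive group",
Knapp–Vogan 1995, Def. 4.29 (iii); Knapp 2002, VII.§2), not a dischargeable fact.
[cite: KnappVogan1995, Def. 4.29 (iii)] -/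
theorem not_forall_hasCartanDecomposition [Nontrivial A] [Nonempty N] :
    ¬ ∀ G : RealMatrixGroup A N, G.HasCartanDecomposition := by
  intro hall
  obtain ⟨i⟩ := ‹Nonempty N›
  -- `GL N A` with the zero Lie algebra
  let G : RealMatrixGroup A N :=
    { carrier := ⊤
      lie := ⊥
      expGL_smul_mem := fun _ _ _ ↦ Subgroup.mem_top _
      conj_mem_lie := fun g _ X hX ↦ by
        rw [LieSubalgebra.mem_bot] at hX ⊢
        rw [hX, mul_zero, zero_mul]
      star_mem := fun _ _ ↦ Subgroup.mem_top _
      isClosed := by simp }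
  have hle : (⊤ : Subgroup (GL N A)) ≤ unitarySubgroupGL A N :=
    (G.hasCartanDecomposition_iff_of_lie_eq_bot rfl).mp (hall G)
  -- the scalar unit `2`
  let u : Aˣ := (Units.mk0 (2 : ℚ) two_ne_zero).map (algebraMap ℚ A).toMonoidHom
  have hu : (u : A) = 2 := map_ofNat (algebraMap ℚ A) 2
  let g : GL N A := u.map (Matrix.scalar N : A →+* Matrix N N A).toMonoidHom
  have hg : (g : Matrix N N A) = Matrix.diagonal fun _ ↦ (2 : A) := by
    rw [← hu]; exact Matrix.scalar_apply _
  have hunit : star (g : Matrix N N A) * g = 1 :=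
    (mem_unitarySubgroupGL_iff g).mp (hle (Subgroup.mem_top g))
  rw [hg, Matrix.star_eq_conjTranspose, Matrix.diagonal_conjTranspose, Matrix.diagonal_mul_diagonal]
    at hunit
  have h22 : (2 : A) * 2 = 1 := by
    have := congrFun (congrFun hunit i) i
    simpa [Pi.star_def, star_ofNat] using this
  have hinj : Function.Injective (algebraMap ℚ A) := (algebraMap ℚ A).injective
  have h' : algebraMap ℚ A (2 * 2) = algebraMap ℚ A 1 := by
    rw [map_mul, map_one, map_ofNat, h22]
  have := hinj h'
  norm_num at this

/-- In particular there is a linear real group `G ≤ GL₁(ℝ)` without the global Cartan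
decomposition, so `RealMatrixGroup.HasCartanDecomposition` has no universal "discharge".
Knapp–Vogan 1995, Def. 4.29 (iii). [cite: KnappVogan1995, Def. 4.29 (iii)] -/
theorem exists_not_hasCartanDecomposition :
    ∃ G : RealMatrixGroup ℝ (Fin 1), ¬ G.HasCartanDecomposition :=
  not_forall.mp not_forall_hasCartanDecomposition


/-! ## A closed linear group with its honest Lie algebra and no Cartan decomposition: `GL_N(ℤ)`

The failure above is not an artefact of the freedom to choose the Lie algebra field `lie` too
small: for the discrete closed subgroup `GL_N(ℤ) ≤ GL_N(ℝ)` (stable under transpose) *every*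
admissible Lie algebra is `0` (a one-parameter group `t ↦ exp (t X)` with integer entries is
constant), while `GL_N(ℤ) ⊄ O(N)` for `N = Fin 2`. This is the mechanism pointed out in
Knapp–Vogan 1995 after Def. 4.29: the global Cartan decomposition forces finitely many connected
components. -/

section Integral

variable {N : Type*} [Fintype N] [DecidableEq N]

/-- Membership in `GL_N(ℤ) ≤ GL_N(ℝ)` (the range of `GL_N(ℤ) → GL_N(ℝ)`): `g` and `g⁻¹` have
integer entries. [folklore] -/
theorem mem_range_map_intCast_iff (g : GL N ℝ) :
    g ∈ (Matrix.GeneralLinearGroup.map (n := N) (Int.castRingHom ℝ)).range ↔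
      (∀ i j, (g : Matrix N N ℝ) i j ∈ Set.range ((↑) : ℤ → ℝ)) ∧
        ∀ i j, ((g⁻¹ : GL N ℝ) : Matrix N N ℝ) i j ∈ Set.range ((↑) : ℤ → ℝ) := by
  constructor
  · rintro ⟨γ, rfl⟩
    exact ⟨fun i j ↦ ⟨(γ : Matrix N N ℤ) i j, rfl⟩, fun i j ↦ ⟨((γ⁻¹ : GL N ℤ) : Matrix N N ℤ) i j, rfl⟩⟩
  · rintro ⟨h, h'⟩
    choose M hM using h
    choose M' hM' using h'
    have hMg : (Int.castRingHom ℝ).mapMatrix (Matrix.of M) = (g : Matrix N N ℝ) := by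
      ext i j; exact hM i j
    have hM'g : (Int.castRingHom ℝ).mapMatrix (Matrix.of M') = ((g⁻¹ : GL N ℝ) : Matrix N N ℝ) := by
      ext i j; exact hM' i j
    have hinj : Function.Injective ((Int.castRingHom ℝ).mapMatrix : Matrix N N ℤ →+* Matrix N N ℝ) :=
      Matrix.map_injective Int.cast_injective
    have h1 : Matrix.of M * Matrix.of M' = 1 := hinj (by
      rw [map_mul, map_one, hMg, hM'g, ← Units.val_mul, mul_inv_cancel, Units.val_one])
    have h2 : Matrix.of M' * Matrix.of M = 1 := hinj (by
      rw [map_mul, map_one, hMg, hM'g, ← Units.val_mul, inv_mul_cancel, Units.val_one])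
    refine ⟨⟨Matrix.of M, Matrix.of M', h1, h2⟩, ?_⟩
    ext i j
    exact hM i j

/-- `GL_N(ℤ)` is closed in `GL_N(ℝ)` (integrality of the entries of `g` and `g⁻¹` is a closed
condition). [folklore] -/
theorem isClosed_range_map_intCast :
    IsClosed ((Matrix.GeneralLinearGroup.map (n := N) (Int.castRingHom ℝ)).range : Set (GL N ℝ)) := by
  have hZ : IsClosed (Set.range ((↑) : ℤ → ℝ)) := Int.isClosedEmbedding_coe_real.isClosed_range
  have hval : Continuous fun g : GL N ℝ ↦ (g : Matrix N N ℝ) := Units.continuous_val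
  have hinv : Continuous fun g : GL N ℝ ↦ ((g⁻¹ : GL N ℝ) : Matrix N N ℝ) := Units.continuous_coe_inv
  have key : ((Matrix.GeneralLinearGroup.map (n := N) (Int.castRingHom ℝ)).range : Set (GL N ℝ)) =
      (⋂ i, ⋂ j, (fun g : GL N ℝ ↦ (g : Matrix N N ℝ) i j) ⁻¹' Set.range ((↑) : ℤ → ℝ)) ∩
        ⋂ i, ⋂ j, (fun g : GL N ℝ ↦ ((g⁻¹ : GL N ℝ) : Matrix N N ℝ) i j) ⁻¹' Set.range ((↑) : ℤ → ℝ) := by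
    ext g
    rw [SetLike.mem_coe, mem_range_map_intCast_iff]
    simp only [Set.mem_inter_iff, Set.mem_iInter, Set.mem_preimage]
  rw [key]
  exact (isClosed_iInter fun i ↦ isClosed_iInter fun j ↦ hZ.preimage (hval.matrix_elem i j)).inter
    (isClosed_iInter fun i ↦ isClosed_iInter fun j ↦ hZ.preimage (hinv.matrix_elem i j))

/-- `GL_N(ℤ)` is stable under (conjugate) transpose. [folklore] -/
theorem star_mem_range_map_intCast {g : GL N ℝ}
    (hg : g ∈ (Matrix.GeneralLinearGroup.map (n := N) (Int.castRingHom ℝ)).range) :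
    star g ∈ (Matrix.GeneralLinearGroup.map (n := N) (Int.castRingHom ℝ)).range := by
  rw [mem_range_map_intCast_iff] at hg ⊢
  refine ⟨fun i j ↦ ?_, fun i j ↦ ?_⟩
  · rw [Units.coe_star, Matrix.star_apply, star_trivial]
    exact hg.1 j i
  · rw [Units.coe_star_inv, Matrix.star_apply, star_trivial]
    exact hg.2 j i

/-- `GL_N(ℤ) ≤ GL_N(ℝ)` with the zero Lie algebra is a linear real group. [folklore] -/
theorem exists_carrier_eq_range_map_intCast :
    ∃ G : RealMatrixGroup ℝ N,
      G.carrier = (Matrix.GeneralLinearGroup.map (n := N) (Int.castRingHom ℝ)).range ∧ G.lie = ⊥ :=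
  ⟨{ carrier := (Matrix.GeneralLinearGroup.map (n := N) (Int.castRingHom ℝ)).range
     lie := ⊥
     expGL_smul_mem := fun X hX t ↦ by
       rw [LieSubalgebra.mem_bot] at hX
       rw [hX, smul_zero, expGL_zero]
       exact Subgroup.one_mem _
     conj_mem_lie := fun g _ X hX ↦ by
       rw [LieSubalgebra.mem_bot] at hX ⊢
       rw [hX, mul_zero, zero_mul]
     star_mem := fun _ hg ↦ star_mem_range_map_intCast hg
     isClosed := isClosed_range_map_intCast }, rfl, rfl⟩

-- The scoped `L∞` operator norm on matrices (only reducibly defeq to the Pi topology, as in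
-- `Mathlib/Analysis/Normed/Algebra/MatrixExponential.lean`) is used for `exp_continuous` and
-- `hasDerivAt_exp_smul_const'`.
set_option backward.isDefEq.respectTransparency false in
open scoped Matrix.Norms.Operator in
/-- **Every admissible Lie algebra of `GL_N(ℤ)` is `0`.** If `G` is a linear real group with
`G ⊆ GL_N(ℤ)`, then `𝔤 = 0`: for `X ∈ 𝔤` the one-parameter group `t ↦ exp (t X)` has integer
entries, hence (ℝ connected, ℤ discrete, `exp` continuous) is constant `= 1`, and differentiating
at `t = 0` gives `X = 0`. [folklore] -/
theorem lie_eq_bot_of_carrier_le_range_map_intCast (G : RealMatrixGroup ℝ N)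
    (hG : G.carrier ≤ (Matrix.GeneralLinearGroup.map (n := N) (Int.castRingHom ℝ)).range) :
    G.lie = ⊥ := by
  rw [LieSubalgebra.eq_bot_iff]
  intro X hX
  -- the entries of `exp (t X)` are integers
  have hint : ∀ (t : ℝ) (i j : N), (exp (t • X) : Matrix N N ℝ) i j ∈ Set.range ((↑) : ℤ → ℝ) :=
    fun t i j ↦ ((mem_range_map_intCast_iff _).mp (hG (G.expGL_smul_mem X hX t))).1 i j
  have hcont : Continuous fun t : ℝ ↦ exp (t • X) :=
    exp_continuous.comp (continuous_id.smul continuous_const)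
  -- hence `exp (t X) = 1` for all `t`
  have hconst : ∀ t : ℝ, exp (t • X) = (1 : Matrix N N ℝ) := by
    intro t
    ext i j
    have h := (isPreconnected_univ (α := ℝ)).constant_of_mapsTo
      Int.isClosedEmbedding_coe_real.isEmbedding.isDiscrete_range (hcont.matrix_elem i j).continuousOn
      (fun s _ ↦ hint s i j) (Set.mem_univ t) (Set.mem_univ 0)
    rw [h, zero_smul, exp_zero]
  -- differentiate at `0`
  have hderiv : HasDerivAt (fun u : ℝ ↦ exp (u • X)) (X * exp ((0 : ℝ) • X)) 0 :=
    hasDerivAt_exp_smul_const' (𝕂 := ℝ) X 0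
  have hderiv0 : HasDerivAt (fun u : ℝ ↦ exp (u • X)) (0 : Matrix N N ℝ) 0 := by
    rw [show (fun u : ℝ ↦ exp (u • X)) = fun _ ↦ (1 : Matrix N N ℝ) from funext hconst]
    exact hasDerivAt_const 0 1
  have h := hderiv.unique hderiv0
  rwa [zero_smul, exp_zero, mul_one] at h

/-- **No linear real group structure on `GL₂(ℤ)` has the global Cartan decomposition**: its Lie
algebra is `0` (`lie_eq_bot_of_carrier_le_range_map_intCast`), so the decomposition would force
`GL₂(ℤ) ⊆ O(2)` (`hasCartanDecomposition_iff_of_lie_eq_bot`), but the unipotent matrix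
`[[1, 1], [0, 1]] ∈ GL₂(ℤ)` is not orthogonal. Knapp–Vogan 1995, Def. 4.29 (iii) and the remark
that (iii) forces finitely many components. [cite: KnappVogan1995, Def. 4.29 (iii)] -/
theorem not_hasCartanDecomposition_of_carrier_eq_range_map_intCast (G : RealMatrixGroup ℝ (Fin 2))
    (hG : G.carrier = (Matrix.GeneralLinearGroup.map (n := Fin 2) (Int.castRingHom ℝ)).range) :
    ¬ G.HasCartanDecomposition := by
  rw [G.hasCartanDecomposition_iff_of_lie_eq_bot
    (G.lie_eq_bot_of_carrier_le_range_map_intCast hG.le), hG]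
  intro hle
  let T : GL (Fin 2) ℤ :=
    ⟨!![1, 1; 0, 1], !![1, -1; 0, 1], by decide, by decide⟩
  have hT : star ((Matrix.GeneralLinearGroup.map (Int.castRingHom ℝ) T : GL (Fin 2) ℝ) :
      Matrix (Fin 2) (Fin 2) ℝ) * (Matrix.GeneralLinearGroup.map (Int.castRingHom ℝ) T : GL (Fin 2) ℝ) = 1 :=
    (mem_unitarySubgroupGL_iff _).mp (hle ⟨T, rfl⟩)
  have h := congrFun (congrFun hT 1) 1
  simp [Matrix.mul_apply, Fin.sum_univ_two, Matrix.star_apply, T] at h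

/-- Summary: there is a closed, transpose-stable subgroup `Γ ≤ GL₂(ℝ)` (namely `GL₂(ℤ)`) carrying
linear real group structures, none of which has the global Cartan decomposition — the predicate
`RealMatrixGroup.HasCartanDecomposition` is a genuine axiom (Knapp–Vogan 1995, Def. 4.29 (iii)).
[cite: KnappVogan1995, Def. 4.29 (iii)] -/
theorem exists_carrier_forall_not_hasCartanDecomposition :
    ∃ Γ : Subgroup (GL (Fin 2) ℝ), (∃ G : RealMatrixGroup ℝ (Fin 2), G.carrier = Γ) ∧
      ∀ G : RealMatrixGroup ℝ (Fin 2), G.carrier = Γ → ¬ G.HasCartanDecomposition :=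
  ⟨_, (exists_carrier_eq_range_map_intCast (N := Fin 2)).imp fun _ h ↦ h.1,
    not_hasCartanDecomposition_of_carrier_eq_range_map_intCast⟩

end Integral

end RealMatrixGroup

end Literature.NumberTheory.Automorphic
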